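import Summits.CriticalPhenomena.PercolationContinuityZ3.Theorems.PercNearOneGluingNoHeavyQuantFiveAtomsHeavy
import HarnessLib

/-!
# QUANT lane R8, T-DEC: the five-atom law at floor `s/4`, regime `8/3 ≤ s < 3` (four leaves; continuation of `…QuantFiveAtomsHeavy`)
# (prim-quant-census-2 gen 80)

builds on p205010 (kernel theorem, internal audit signed; external expert review pending)

Support file (`--supports stmt-CriticalPhenomena-4575`), QUANT lane census seat prim-quant-census-2 (gen 80); memo
`run/shared/lean/prim/quant/prim-quant-census-2-g80/TRIPLE-G80.md` §5.  Theorems only, standard axioms, no sorries, no definitions.  The width-4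
analogue of `…QuantFourAtomsHeavy`: an abstract law `p₀δ₀ + p₁δ_k + p₂δ_{2k} + p₃δ_{3k} + p₄δ_{4k}` (`pᵢ ≥ 0`, `Σ pᵢ = 1`, `p₁+2p₂+3p₃+4p₄ = s`) carries
a HEAVY decomposition (pairs with gate `≥ s/4` and credit `≥ s·k`, self-sufficient points; inline `∃` as in `…QuantHeavyShift`) at floor `s/4`, target
`s·k`.  The only lows are `0` and (for `s > 2`) `k`.  `s ≤ 1`: the zero ships to `k,2k,3k,4k` at the credit gates `s/b`, exactly; `1 < s ≤ 2`: `k` stands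
alone, the zero ships to `2k,3k,4k`; `2 < s ≤ 8/3`: `k → 2k` at the floor gate, zero → `4k` then `3k` (gate `s/3`); `8/3 ≤ s < 3`: `k → 2k` at gate `s−2`
then `3k`, zero → `4k` then `3k`; `3 ≤ s < 4`: zero → `4k`, `k → 3k`.  The capacity hypotheses of the last three regimes are stated explicitly; for the
four-blob weights they are polynomial inequalities in `(c, g)` (`…QuantFourBlobAverageFloor`).

HONEST STATUS.  Tools; `SiblingStep`, `FarTreeRow` OPEN; RATE class (log\*) / honest sentence of `run/shared/lean/prim/quant/README.md` unchanged.
[this work].  Nothing here is cited as a published result.  The gluing rows served [cite: KozmaNitzan2024, Conjecture 3 (p. 15)]; product measure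
[cite: Grimmett1999, §1.3 p. 10].
-/

noncomputable section

open scoped BigOperators

namespace Summit.CriticalPhenomena.PercolationContinuityZ3.Theorems
namespace Quant

open Finset

/-- the two-point law `{lo, hi; g}` (as in `…QuantLawDEC`) -/
local notation3 "TP[" lo ", " hi ", " g ", " h "]" =>
  (g : ℝ) * (if (h : ℕ) = (hi : ℕ) then (1 : ℝ) else 0) + (1 - (g : ℝ)) * (if (h : ℕ) = (lo : ℕ) then (1 : ℝ) else 0)

namespace LawDec

/-! ### Regime `8/3 ≤ s < 3` -/

/-- regime `8/3 ≤ s < 3`: `k → 2k` at gate `s − 2` (then `3k` at the floor gate), the zero to `4k` at the floor gate (then `3k` at gate `s/3`); three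
leaves by which of the two first absorbers saturates (not both: hypothesis `hdisj`); capacity hypotheses `hZ` (zero overflow), `hO` (one overflow). [this work] -/
theorem heavy_fiveAtoms_r3hi (k : ℕ) (p₀ p₁ p₂ p₃ p₄ s : ℝ) (hp₀0 : 0 ≤ p₀) (hp₁0 : 0 ≤ p₁) (hp₂0 : 0 ≤ p₂)
    (hp₃0 : 0 ≤ p₃) (hp₄0 : 0 ≤ p₄) (hsum : p₀ + p₁ + p₂ + p₃ + p₄ = 1) (_hmean : p₁ + 2 * p₂ + 3 * p₃ + 4 * p₄ = s) (hs0 : 0 < s) (h83 : 8 / 3 ≤ s) (h3 : s < 3)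
    (hZ : s * (s / 4 * p₀ - (1 - s / 4) * p₄) ≤ (3 - s) * (s / 4) * p₃)
    (hO : s / 4 * ((s - 2) * p₁ - (3 - s) * p₂) ≤ (1 - s / 4) * (s - 2) * p₃)
    (hdisj : s / 4 * p₀ ≤ (1 - s / 4) * p₄ ∨ (s - 2) * p₁ ≤ (3 - s) * p₂) :
    ∃ (ι : Type) (_ : Fintype ι) (lam γ : ι → ℝ) (lo hi : ι → ℕ),
      (∀ i, 0 ≤ lam i) ∧ (∑ i, lam i = 1) ∧ (∀ i, 0 ≤ γ i ∧ γ i ≤ 1) ∧ (∀ i, lo i ≤ hi i) ∧ (∀ i, hi i ≤ 4 * k) ∧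
      (∀ h, (p₀ * (if h = 0 then (1 : ℝ) else 0) + p₁ * (if h = k then (1 : ℝ) else 0) + p₂ * (if h = 2 * k then (1 : ℝ) else 0)
          + p₃ * (if h = 3 * k then (1 : ℝ) else 0) + p₄ * (if h = 4 * k then (1 : ℝ) else 0)) = ∑ i, lam i * TP[lo i, hi i, γ i, h]) ∧
      (∀ i, 0 < lam i → s / 4 ≤ γ i ∧ s * k ≤ 2 * (lo i : ℝ) + ((hi i : ℝ) - lo i) * γ i) := by
  have hk0 : (0 : ℝ) ≤ k := Nat.cast_nonneg k
  have hsne : s ≠ 0 := hs0.ne'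
  have c2k : ((2 * k : ℕ) : ℝ) = 2 * (k : ℝ) := by push_cast; ring
  have c3k : ((3 * k : ℕ) : ℝ) = 3 * (k : ℝ) := by push_cast; ring
  have c4k : ((4 * k : ℕ) : ℝ) = 4 * (k : ℝ) := by push_cast; ring
  obtain ⟨x, hx⟩ : ∃ x : ℝ, x = s / 4 := ⟨_, rfl⟩
  have hx0 : 0 < x := by rw [hx]; positivity
  have hx1 : x < 1 := by rw [hx]; linarith
  have h1x : 0 < 1 - x := by linarith
  have hxne : x ≠ 0 := hx0.ne'
  have h1xne : 1 - x ≠ 0 := h1x.ne'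
  have hsk4 : s * (k : ℝ) ≤ 4 * k := mul_le_mul_of_nonneg_right (by linarith : s ≤ 4) hk0
  rw [← hx] at hZ hO hdisj
  have hsk3 : s * (k : ℝ) ≤ 3 * k := mul_le_mul_of_nonneg_right h3.le hk0
  have h3s : 0 < 3 - s := by linarith
  have h3sne : 3 - s ≠ 0 := h3s.ne'
  have hs2 : 0 < s - 2 := by linarith
  have hs2ne : s - 2 ≠ 0 := hs2.ne'
  have h13 : 0 < 1 - s / 3 := by linarith
  have h13ne : 1 - s / 3 ≠ 0 := h13.ne'
  have hg2 : s / 4 ≤ s - 2 := by linarith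
  have hg21 : s - 2 ≤ 1 := by linarith
  by_cases hzf : x * p₀ ≤ (1 - x) * p₄
  · have hr4 : 0 ≤ p₄ - p₀ / (1 - x) * x := by
      rw [sub_nonneg, div_mul_eq_mul_div, div_le_iff₀ h1x]; linarith
    by_cases hof : (s - 2) * p₁ ≤ (3 - s) * p₂
    · -- both fit
      have hr2 : 0 ≤ p₂ - p₁ / (3 - s) * (s - 2) := by
        rw [sub_nonneg, div_mul_eq_mul_div, div_le_iff₀ h3s]; linarith
      refine ⟨Fin 5, inferInstance, ![p₁ / (3 - s), p₀ / (1 - x), p₂ - p₁ / (3 - s) * (s - 2), p₃, p₄ - p₀ / (1 - x) * x],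
        ![s - 2, x, 1, 1, 1], ![k, 0, 2 * k, 3 * k, 4 * k], ![2 * k, 4 * k, 2 * k, 3 * k, 4 * k], ?_, ?_, ?_, ?_, ?_, fun h => ?_, ?_⟩
      · intro i; fin_cases i
        · show (0 : ℝ) ≤ p₁ / (3 - s)
          exact div_nonneg hp₁0 h3s.le
        · show (0 : ℝ) ≤ p₀ / (1 - x)
          exact div_nonneg hp₀0 h1x.le
        · show (0 : ℝ) ≤ p₂ - p₁ / (3 - s) * (s - 2)
          exact hr2
        · show (0 : ℝ) ≤ p₃
          exact hp₃0
        · show (0 : ℝ) ≤ p₄ - p₀ / (1 - x) * x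
          exact hr4
      · rw [Fin.sum_univ_five]
        show (p₁ / (3 - s)) + (p₀ / (1 - x)) + (p₂ - p₁ / (3 - s) * (s - 2)) + p₃ + (p₄ - p₀ / (1 - x) * x) = 1
        have e : (p₁ / (3 - s)) + (p₀ / (1 - x)) + (p₂ - p₁ / (3 - s) * (s - 2)) + (p₃) + (p₄ - p₀ / (1 - x) * x) = p₀ + p₁ + p₂ + p₃ + p₄ := by
          field_simp
          ring
        rw [e, hsum]
      · intro i; fin_cases i
        · show (0 : ℝ) ≤ s - 2 ∧ s - 2 ≤ 1
          exact ⟨by linarith, hg21⟩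
        · show (0 : ℝ) ≤ x ∧ x ≤ 1
          exact ⟨hx0.le, hx1.le⟩
        · show (0 : ℝ) ≤ 1 ∧ 1 ≤ 1
          exact ⟨zero_le_one, le_rfl⟩
        · show (0 : ℝ) ≤ 1 ∧ 1 ≤ 1
          exact ⟨zero_le_one, le_rfl⟩
        · show (0 : ℝ) ≤ 1 ∧ 1 ≤ 1
          exact ⟨zero_le_one, le_rfl⟩
      · intro i; fin_cases i
        · show k ≤ 2 * k; omega
        · exact Nat.zero_le _
        · exact le_rfl
        · exact le_rfl
        · exact le_rfl
      · intro i; fin_cases i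
        · show 2 * k ≤ 4 * k; omega
        · exact le_rfl
        · show 2 * k ≤ 4 * k; omega
        · show 3 * k ≤ 4 * k; omega
        · exact le_rfl
      · rw [Fin.sum_univ_five]
        show _ = (p₁ / (3 - s)) * TP[k, 2 * k, (s - 2), h]
          + (p₀ / (1 - x)) * TP[0, 4 * k, (x), h]
          + (p₂ - p₁ / (3 - s) * (s - 2)) * TP[2 * k, 2 * k, (1), h]
          + (p₃) * TP[3 * k, 3 * k, (1), h]
          + (p₄ - p₀ / (1 - x) * x) * TP[4 * k, 4 * k, (1), h]
        field_simp
        ring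
      · intro i hi
        clear hi
        fin_cases i
        · show s / 4 ≤ s - 2 ∧ s * k ≤ 2 * (k : ℝ) + (((2 * k : ℕ) : ℝ) - (k : ℝ)) * (s - 2)
          rw [c2k]
          exact ⟨by linarith, by linarith⟩
        · show s / 4 ≤ x ∧ s * k ≤ 2 * ((0 : ℕ) : ℝ) + (((4 * k : ℕ) : ℝ) - ((0 : ℕ) : ℝ)) * (x)
          rw [c4k, hx]
          push_cast
          exact ⟨by linarith, by linarith⟩
        · show s / 4 ≤ 1 ∧ s * k ≤ 2 * ((2 * k : ℕ) : ℝ) + (((2 * k : ℕ) : ℝ) - ((2 * k : ℕ) : ℝ)) * (1)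
          rw [c2k]
          exact ⟨by linarith, by linarith [hsk4]⟩
        · show s / 4 ≤ 1 ∧ s * k ≤ 2 * ((3 * k : ℕ) : ℝ) + (((3 * k : ℕ) : ℝ) - ((3 * k : ℕ) : ℝ)) * (1)
          rw [c3k]
          exact ⟨by linarith, by linarith [hsk4]⟩
        · show s / 4 ≤ 1 ∧ s * k ≤ 2 * ((4 * k : ℕ) : ℝ) + (((4 * k : ℕ) : ℝ) - ((4 * k : ℕ) : ℝ)) * (1)
          rw [c4k]
          exact ⟨by linarith, by linarith [hsk4]⟩
    · -- one overflows into 3k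
      have hof' : (3 - s) * p₂ < (s - 2) * p₁ := lt_of_not_ge hof
      have hl3 : 0 ≤ (p₁ - p₂ / (s - 2) * (3 - s)) / (1 - x) := by
        refine div_nonneg ?_ h1x.le
        rw [sub_nonneg, div_mul_eq_mul_div, div_le_iff₀ hs2]; linarith
      have hr3 : 0 ≤ p₃ - (p₁ - p₂ / (s - 2) * (3 - s)) / (1 - x) * x := by
        have e : (p₁ - p₂ / (s - 2) * (3 - s)) / (1 - x) * x = x * ((s - 2) * p₁ - (3 - s) * p₂) / ((1 - x) * (s - 2)) := by
          field_simp
        rw [e, sub_nonneg, div_le_iff₀ (mul_pos h1x hs2)]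
        linarith
      refine ⟨Fin 5, inferInstance, ![p₂ / (s - 2), (p₁ - p₂ / (s - 2) * (3 - s)) / (1 - x), p₀ / (1 - x), p₃ - (p₁ - p₂ / (s - 2) * (3 - s)) / (1 - x) * x, p₄ - p₀ / (1 - x) * x],
        ![s - 2, x, x, 1, 1], ![k, k, 0, 3 * k, 4 * k], ![2 * k, 3 * k, 4 * k, 3 * k, 4 * k], ?_, ?_, ?_, ?_, ?_, fun h => ?_, ?_⟩
      · intro i; fin_cases i
        · show (0 : ℝ) ≤ p₂ / (s - 2)
          exact div_nonneg hp₂0 hs2.le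
        · show (0 : ℝ) ≤ (p₁ - p₂ / (s - 2) * (3 - s)) / (1 - x)
          exact hl3
        · show (0 : ℝ) ≤ p₀ / (1 - x)
          exact div_nonneg hp₀0 h1x.le
        · show (0 : ℝ) ≤ p₃ - (p₁ - p₂ / (s - 2) * (3 - s)) / (1 - x) * x
          exact hr3
        · show (0 : ℝ) ≤ p₄ - p₀ / (1 - x) * x
          exact hr4
      · rw [Fin.sum_univ_five]
        show (p₂ / (s - 2)) + ((p₁ - p₂ / (s - 2) * (3 - s)) / (1 - x)) + (p₀ / (1 - x)) + (p₃ - (p₁ - p₂ / (s - 2) * (3 - s)) / (1 - x) * x) + (p₄ - p₀ / (1 - x) * x) = 1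
        have e : (p₂ / (s - 2)) + ((p₁ - p₂ / (s - 2) * (3 - s)) / (1 - x)) + (p₀ / (1 - x)) + (p₃ - (p₁ - p₂ / (s - 2) * (3 - s)) / (1 - x) * x) + (p₄ - p₀ / (1 - x) * x) = p₀ + p₁ + p₂ + p₃ + p₄ := by
          field_simp
          ring
        rw [e, hsum]
      · intro i; fin_cases i
        · show (0 : ℝ) ≤ s - 2 ∧ s - 2 ≤ 1
          exact ⟨by linarith, hg21⟩
        · show (0 : ℝ) ≤ x ∧ x ≤ 1
          exact ⟨hx0.le, hx1.le⟩
        · show (0 : ℝ) ≤ x ∧ x ≤ 1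
          exact ⟨hx0.le, hx1.le⟩
        · show (0 : ℝ) ≤ 1 ∧ 1 ≤ 1
          exact ⟨zero_le_one, le_rfl⟩
        · show (0 : ℝ) ≤ 1 ∧ 1 ≤ 1
          exact ⟨zero_le_one, le_rfl⟩
      · intro i; fin_cases i
        · show k ≤ 2 * k; omega
        · show k ≤ 3 * k; omega
        · exact Nat.zero_le _
        · exact le_rfl
        · exact le_rfl
      · intro i; fin_cases i
        · show 2 * k ≤ 4 * k; omega
        · show 3 * k ≤ 4 * k; omega
        · exact le_rfl
        · show 3 * k ≤ 4 * k; omega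
        · exact le_rfl
      · rw [Fin.sum_univ_five]
        show _ = (p₂ / (s - 2)) * TP[k, 2 * k, (s - 2), h]
          + ((p₁ - p₂ / (s - 2) * (3 - s)) / (1 - x)) * TP[k, 3 * k, (x), h]
          + (p₀ / (1 - x)) * TP[0, 4 * k, (x), h]
          + (p₃ - (p₁ - p₂ / (s - 2) * (3 - s)) / (1 - x) * x) * TP[3 * k, 3 * k, (1), h]
          + (p₄ - p₀ / (1 - x) * x) * TP[4 * k, 4 * k, (1), h]
        field_simp
        ring
      · intro i hi
        clear hi
        fin_cases i
        · show s / 4 ≤ s - 2 ∧ s * k ≤ 2 * (k : ℝ) + (((2 * k : ℕ) : ℝ) - (k : ℝ)) * (s - 2)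
          rw [c2k]
          exact ⟨by linarith, by linarith⟩
        · show s / 4 ≤ x ∧ s * k ≤ 2 * (k : ℝ) + (((3 * k : ℕ) : ℝ) - (k : ℝ)) * (x)
          rw [c3k, hx]
          exact ⟨by linarith, by linarith [hsk3]⟩
        · show s / 4 ≤ x ∧ s * k ≤ 2 * ((0 : ℕ) : ℝ) + (((4 * k : ℕ) : ℝ) - ((0 : ℕ) : ℝ)) * (x)
          rw [c4k, hx]
          push_cast
          exact ⟨by linarith, by linarith⟩
        · show s / 4 ≤ 1 ∧ s * k ≤ 2 * ((3 * k : ℕ) : ℝ) + (((3 * k : ℕ) : ℝ) - ((3 * k : ℕ) : ℝ)) * (1)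
          rw [c3k]
          exact ⟨by linarith, by linarith [hsk4]⟩
        · show s / 4 ≤ 1 ∧ s * k ≤ 2 * ((4 * k : ℕ) : ℝ) + (((4 * k : ℕ) : ℝ) - ((4 * k : ℕ) : ℝ)) * (1)
          rw [c4k]
          exact ⟨by linarith, by linarith [hsk4]⟩
  · have hzf' : (1 - x) * p₄ < x * p₀ := lt_of_not_ge hzf
    have hl0 : 0 ≤ (p₀ - p₄ / x * (1 - x)) / (1 - s / 3) := by
      refine div_nonneg ?_ h13.le
      rw [sub_nonneg, div_mul_eq_mul_div, div_le_iff₀ hx0]; linarith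
    by_cases hof : (s - 2) * p₁ ≤ (3 - s) * p₂
    · -- zero overflows into 3k, one fits
      have hr2 : 0 ≤ p₂ - p₁ / (3 - s) * (s - 2) := by
        rw [sub_nonneg, div_mul_eq_mul_div, div_le_iff₀ h3s]; linarith
      have hr3 : 0 ≤ p₃ - (p₀ - p₄ / x * (1 - x)) / (1 - s / 3) * (s / 3) := by
        have e : (p₀ - p₄ / x * (1 - x)) / (1 - s / 3) * (s / 3) = s * (x * p₀ - (1 - x) * p₄) / ((3 - s) * x) := by
          field_simp
        rw [e, sub_nonneg, div_le_iff₀ (mul_pos h3s hx0)]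
        linarith
      refine ⟨Fin 5, inferInstance, ![p₁ / (3 - s), p₄ / x, (p₀ - p₄ / x * (1 - x)) / (1 - s / 3), p₂ - p₁ / (3 - s) * (s - 2), p₃ - (p₀ - p₄ / x * (1 - x)) / (1 - s / 3) * (s / 3)],
        ![s - 2, x, s / 3, 1, 1], ![k, 0, 0, 2 * k, 3 * k], ![2 * k, 4 * k, 3 * k, 2 * k, 3 * k], ?_, ?_, ?_, ?_, ?_, fun h => ?_, ?_⟩
      · intro i; fin_cases i
        · show (0 : ℝ) ≤ p₁ / (3 - s)
          exact div_nonneg hp₁0 h3s.le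
        · show (0 : ℝ) ≤ p₄ / x
          exact div_nonneg hp₄0 hx0.le
        · show (0 : ℝ) ≤ (p₀ - p₄ / x * (1 - x)) / (1 - s / 3)
          exact hl0
        · show (0 : ℝ) ≤ p₂ - p₁ / (3 - s) * (s - 2)
          exact hr2
        · show (0 : ℝ) ≤ p₃ - (p₀ - p₄ / x * (1 - x)) / (1 - s / 3) * (s / 3)
          exact hr3
      · rw [Fin.sum_univ_five]
        show (p₁ / (3 - s)) + p₄ / x + ((p₀ - p₄ / x * (1 - x)) / (1 - s / 3)) + (p₂ - p₁ / (3 - s) * (s - 2)) + (p₃ - (p₀ - p₄ / x * (1 - x)) / (1 - s / 3) * (s / 3)) = 1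
        have e : (p₁ / (3 - s)) + (p₄ / x) + ((p₀ - p₄ / x * (1 - x)) / (1 - s / 3)) + (p₂ - p₁ / (3 - s) * (s - 2)) + (p₃ - (p₀ - p₄ / x * (1 - x)) / (1 - s / 3) * (s / 3)) = p₀ + p₁ + p₂ + p₃ + p₄ := by
          field_simp
          ring
        rw [e, hsum]
      · intro i; fin_cases i
        · show (0 : ℝ) ≤ s - 2 ∧ s - 2 ≤ 1
          exact ⟨by linarith, hg21⟩
        · show (0 : ℝ) ≤ x ∧ x ≤ 1
          exact ⟨hx0.le, hx1.le⟩
        · show (0 : ℝ) ≤ s / 3 ∧ s / 3 ≤ 1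
          exact ⟨by positivity, by linarith⟩
        · show (0 : ℝ) ≤ 1 ∧ 1 ≤ 1
          exact ⟨zero_le_one, le_rfl⟩
        · show (0 : ℝ) ≤ 1 ∧ 1 ≤ 1
          exact ⟨zero_le_one, le_rfl⟩
      · intro i; fin_cases i
        · show k ≤ 2 * k; omega
        · exact Nat.zero_le _
        · exact Nat.zero_le _
        · exact le_rfl
        · exact le_rfl
      · intro i; fin_cases i
        · show 2 * k ≤ 4 * k; omega
        · exact le_rfl
        · show 3 * k ≤ 4 * k; omega
        · show 2 * k ≤ 4 * k; omega
        · show 3 * k ≤ 4 * k; omega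
      · rw [Fin.sum_univ_five]
        show _ = (p₁ / (3 - s)) * TP[k, 2 * k, (s - 2), h]
          + (p₄ / x) * TP[0, 4 * k, (x), h]
          + ((p₀ - p₄ / x * (1 - x)) / (1 - s / 3)) * TP[0, 3 * k, (s / 3), h]
          + (p₂ - p₁ / (3 - s) * (s - 2)) * TP[2 * k, 2 * k, (1), h]
          + (p₃ - (p₀ - p₄ / x * (1 - x)) / (1 - s / 3) * (s / 3)) * TP[3 * k, 3 * k, (1), h]
        field_simp
        ring
      · intro i hi
        clear hi
        fin_cases i
        · show s / 4 ≤ s - 2 ∧ s * k ≤ 2 * (k : ℝ) + (((2 * k : ℕ) : ℝ) - (k : ℝ)) * (s - 2)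
          rw [c2k]
          exact ⟨by linarith, by linarith⟩
        · show s / 4 ≤ x ∧ s * k ≤ 2 * ((0 : ℕ) : ℝ) + (((4 * k : ℕ) : ℝ) - ((0 : ℕ) : ℝ)) * (x)
          rw [c4k, hx]
          push_cast
          exact ⟨by linarith, by linarith⟩
        · show s / 4 ≤ s / 3 ∧ s * k ≤ 2 * ((0 : ℕ) : ℝ) + (((3 * k : ℕ) : ℝ) - ((0 : ℕ) : ℝ)) * (s / 3)
          rw [c3k]
          push_cast
          exact ⟨by linarith, by linarith⟩
        · show s / 4 ≤ 1 ∧ s * k ≤ 2 * ((2 * k : ℕ) : ℝ) + (((2 * k : ℕ) : ℝ) - ((2 * k : ℕ) : ℝ)) * (1)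
          rw [c2k]
          exact ⟨by linarith, by linarith [hsk4]⟩
        · show s / 4 ≤ 1 ∧ s * k ≤ 2 * ((3 * k : ℕ) : ℝ) + (((3 * k : ℕ) : ℝ) - ((3 * k : ℕ) : ℝ)) * (1)
          rw [c3k]
          exact ⟨by linarith, by linarith [hsk4]⟩
    · -- both overflowing is excluded by the disjunction
      exfalso
      rcases hdisj with h | h
      · exact hzf h
      · exact hof h

end LawDec
end Quant
end Summit.CriticalPhenomena.PercolationContinuityZ3.Theorems
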